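import Summits.Ventures.Crystal3D.Theorems.StickyWulffConstantOptimalCalibrationDefs
import HarnessLib

/-!
# The optimal calibration for the layer-profile ladder toward `StackingLiminf`
# (stmt-Ventures-19145), part I: L1, the structure of `s`, `ω`, `φ`, and the CAP
# (cf-p2 R20, `BLUEPRINT-profileDual.md` §3; planner's Lean companion landed by eng)

Route `StickyWulffConstant` of the venture `Summits/Ventures/Crystal3D` (cell `crystal3d-full`).
Over `StickyWulffConstantOptimalCalibrationDefs` (D1–D5): L1 `layer_identity`
(`ω_M n/√M ≤ d + Ψ₂(n)`); L2 `phiPos_mono`, the CAP `thetaW_cap` (`θ_w(m) ≤ 1 − δ/(c√m)`),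
`thetaW_le_one`, `thetaW_mono`, `thetaW_mul_le_Psi_sub`, `Psi2_le`, `G_mono` (with `G_zero`,
`thetaW_nonneg`, `omega_lt_sqrt`, `three_le_omega`, `three_le_s`, `s_sq`, `s_mono`); L5 exact form
`two_mul_G_top` (`2G(M) = 3M − (2/c)Σφ₊ − (c√M − δ)`); `omega_ge` (`ω_M ≥ β_c − κ_c/√M`) and the
constant identity `ceiling_identity` (`27β_c²B_c/4 = 243 + 54√3c + 45c²/4`).  Proofs: cf-p2 g10,
`HOME/cf-p2/OptimalCalibrationSketch.lean` (evidence #17 on stmt-Ventures-19145), verbatim.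
WHAT THIS IS NOT: the value ESTIMATE `B M − K√M ≤ 2G(M)` (separate file) nor the rung; F-C1 not moved.
-/

noncomputable section

namespace Summit.Ventures.Crystal3D.Theorems.OptimalCalibration

open Finset

/-! ### L1, L2 -/

/-- L1 (layer identity): `12n ≤ d² + 3`, `d ≥ 0`, `n ≥ 1` ⇒ `ω_M n/√M ≤ d + Ψ₂(n)`. -/
theorem layer_identity (c δ : ℝ) (M : ℕ) {n : ℕ} (hn : 1 ≤ n) {d : ℝ} (hd0 : 0 ≤ d)
    (hd : 12 * (n : ℝ) ≤ d ^ 2 + 3) :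
    omega c δ M * n / Real.sqrt M ≤ d + Psi2 c δ M n := by
  have hn0 : n ≠ 0 := by omega
  have hs : Real.sqrt (12 * n - 3) ≤ d := by
    calc Real.sqrt (12 * n - 3) ≤ Real.sqrt (d ^ 2) := Real.sqrt_le_sqrt (by linarith)
      _ = d := Real.sqrt_sq hd0
  simp only [Psi2, hn0, if_false]
  linarith

/-- `θ_w ≥ 0`. -/
theorem thetaW_nonneg {c : ℝ} (hc : 0 < c) (δ : ℝ) (M m : ℕ) : 0 ≤ thetaW c δ M m := by
  unfold thetaW
  split_ifs
  · exact le_rfl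
  · exact div_nonneg (le_max_right _ _) hc.le

/-- `Ψ₂(0) = 0`, `Ψ(0) = 0`, `G(0) = 0`. -/
theorem G_zero (c δ : ℝ) (M : ℕ) : G c δ M 0 = 0 := by
  simp [G, Psi, Psi2]

/-- L2(d): `Ψ₂(m) ≤ c·θ_w(m)·√m` (indeed `Ψ₂(m) = √m·φ(m)`). -/
theorem Psi2_le {c : ℝ} (hc : 0 < c) (δ : ℝ) (M m : ℕ) :
    Psi2 c δ M m ≤ c * thetaW c δ M m * Real.sqrt m := by
  unfold Psi2 thetaW
  rcases Nat.eq_zero_or_pos m with rfl | hm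
  · simp
  · have hm0 : m ≠ 0 := by omega
    have hm' : (0 : ℝ) < m := by exact_mod_cast hm
    simp only [hm0, if_false]
    -- `Ψ₂(m) = √m · φ(m)`
    have hid : omega c δ M * m / Real.sqrt M - Real.sqrt (12 * m - 3) =
        Real.sqrt m * phi c δ M m := by
      unfold phi s
      have h1 : Real.sqrt m * Real.sqrt (12 - 3 / (m : ℝ)) = Real.sqrt (12 * m - 3) := by
        rw [← Real.sqrt_mul hm'.le]
        congr 1
        field_simp
      have h2 : Real.sqrt m * Real.sqrt m = m := Real.mul_self_sqrt hm'.le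
      rw [mul_sub, h1]
      congr 1
      rw [show Real.sqrt ↑m * (omega c δ M * Real.sqrt ↑m / Real.sqrt ↑M) =
        omega c δ M * (Real.sqrt m * Real.sqrt m) / Real.sqrt M by ring, h2]
    rw [hid]
    have h3 : phi c δ M m ≤ max (phi c δ M m) 0 := le_max_left _ _
    have h4 : Real.sqrt m * phi c δ M m ≤ Real.sqrt m * max (phi c δ M m) 0 :=
      mul_le_mul_of_nonneg_left h3 (Real.sqrt_nonneg _)
    have h5 : c * (max (phi c δ M m) 0 / c) * Real.sqrt m = Real.sqrt m * max (phi c δ M m) 0 := by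
      field_simp
    linarith [h5]

/-- L2(a): `φ₊` is nondecreasing on `[1, M]` (blueprint: `φ(m) > 0 ⇒ m > 9M/ω²`, then
`ω m √(m+1) ≥ √M`).  Needs `ω_M² ≤ 27M`, e.g. `c ≤ 2`, `M ≥ 1`. -/
theorem three_le_s {x : ℝ} (hx : 1 ≤ x) : 3 ≤ s x := by
  unfold s
  have hxpos : 0 < x := by linarith
  have h3x : 3 / x ≤ 3 := by rw [div_le_iff₀ hxpos]; linarith
  have h9 : Real.sqrt 9 = 3 := by
    rw [show (9 : ℝ) = 3 ^ 2 by norm_num]; exact Real.sqrt_sq (by norm_num)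
  calc (3 : ℝ) = Real.sqrt 9 := h9.symm
    _ ≤ Real.sqrt (12 - 3 / x) := Real.sqrt_le_sqrt (by linarith)

/-- `s(x)² = 12 − 3/x` for `x ≥ 1`. -/
theorem s_sq {x : ℝ} (hx : 1 ≤ x) : s x ^ 2 = 12 - 3 / x := by
  unfold s
  have hxpos : 0 < x := by linarith
  have h3x : 3 / x ≤ 3 := by rw [div_le_iff₀ hxpos]; linarith
  exact Real.sq_sqrt (by linarith)

/-- `s` is nondecreasing on `[1, ∞)`. -/
theorem s_mono {x y : ℝ} (hx : 1 ≤ x) (hxy : x ≤ y) : s x ≤ s y := by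
  unfold s
  have hxpos : 0 < x := by linarith
  have : 3 / y ≤ 3 / x := div_le_div_of_nonneg_left (by norm_num) hxpos hxy
  exact Real.sqrt_le_sqrt (by linarith)

/-- `ω_M ≥ 3` (indeed `ω_M ≥ c + 3 − δ`). -/
theorem three_le_omega {c δ : ℝ} (hδ : 0 ≤ δ) (hδc : δ ≤ c) {M : ℕ} (hM : 31 ≤ M) :
    3 ≤ omega c δ M := by
  have hM' : (31 : ℝ) ≤ M := by exact_mod_cast hM
  have hM1 : (1 : ℝ) ≤ M := by linarith
  have hsM1 : 1 ≤ Real.sqrt M := by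
    rw [show (1 : ℝ) = Real.sqrt 1 from Real.sqrt_one.symm]; exact Real.sqrt_le_sqrt hM1
  have hsM := three_le_s hM1
  have hd : δ / Real.sqrt M ≤ δ := by
    rw [div_le_iff₀ (by linarith)]; nlinarith
  unfold omega
  linarith

/-- L2(a): `φ₊` is nondecreasing on `1 ≤ m ≤ M` (blueprint §3 L2(a)). -/
theorem phiPos_mono {c δ : ℝ} (_hc : 0 < c) (_hc2 : c ≤ 2) (hδ : 0 ≤ δ) (hδc : δ ≤ c) {M : ℕ}
    (hM : 31 ≤ M) {m : ℕ} (hm : 1 ≤ m) (_hmM : m + 1 ≤ M) :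
    max (phi c δ M m) 0 ≤ max (phi c δ M (m + 1)) 0 := by
  rcases le_or_gt (phi c δ M m) 0 with hle | hpos
  · rw [max_eq_right hle]; exact le_max_right _ _
  · refine max_le (le_trans ?_ (le_max_left _ _)) (le_max_right _ _)
    -- main case: `0 < φ(m)` ⇒ `φ(m) ≤ φ(m+1)`
    have hm' : (1 : ℝ) ≤ m := by exact_mod_cast hm
    have hm1' : (1 : ℝ) ≤ ((m + 1 : ℕ) : ℝ) := by push_cast; linarith
    have hM' : (31 : ℝ) ≤ M := by exact_mod_cast hM
    have hmpos : (0 : ℝ) < m := by linarith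
    have hMpos : (0 : ℝ) < M := by linarith
    set ω : ℝ := omega c δ M with hω
    have hω3 : 3 ≤ ω := three_le_omega hδ hδc hM
    set a : ℝ := Real.sqrt m with ha
    set a' : ℝ := Real.sqrt ((m + 1 : ℕ) : ℝ) with ha'
    set b : ℝ := Real.sqrt M with hb
    have ha2 : a ^ 2 = m := by rw [ha]; exact Real.sq_sqrt hmpos.le
    have ha'2 : a' ^ 2 = (m : ℝ) + 1 := by
      rw [ha']; push_cast; exact Real.sq_sqrt (by linarith)
    have hb2 : b ^ 2 = M := by rw [hb]; exact Real.sq_sqrt hMpos.le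
    have ha1 : 1 ≤ a := by
      rw [ha, show (1 : ℝ) = Real.sqrt 1 from Real.sqrt_one.symm]; exact Real.sqrt_le_sqrt hm'
    have haa' : a ≤ a' := by
      rw [ha, ha']; exact Real.sqrt_le_sqrt (by push_cast; linarith)
    have hbpos : 0 < b := by rw [hb]; exact Real.sqrt_pos.2 hMpos
    have hapos : 0 < a := by linarith
    have ha'pos : 0 < a' := by linarith
    -- the two `s` values
    have hsm3 : 3 ≤ s m := three_le_s hm'
    have hsm2 : s m ^ 2 = 12 - 3 / m := s_sq hm'
    have hsm12 : s ((m + 1 : ℕ) : ℝ) ^ 2 = 12 - 3 / ((m : ℝ) + 1) := by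
      rw [s_sq hm1']; push_cast; ring
    have hsmono : s m ≤ s ((m + 1 : ℕ) : ℝ) := s_mono hm' (by push_cast; linarith)
    -- `a² a'² (s(m+1) − s(m)) ≤ 1/2`
    have hprod : a ^ 2 * a' ^ 2 * ((s ((m + 1 : ℕ) : ℝ) - s m) * (s ((m + 1 : ℕ) : ℝ) + s m)) = 3 := by
      have e : (s ((m + 1 : ℕ) : ℝ) - s m) * (s ((m + 1 : ℕ) : ℝ) + s m) =
          s ((m + 1 : ℕ) : ℝ) ^ 2 - s m ^ 2 := by ring
      rw [e, hsm12, hsm2, ha2, ha'2]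
      have hm0 : (m : ℝ) ≠ 0 := ne_of_gt hmpos
      have hm10 : (m : ℝ) + 1 ≠ 0 := by linarith
      field_simp
      ring
    have hds : 2 * (a ^ 2 * a' ^ 2 * (s ((m + 1 : ℕ) : ℝ) - s m)) ≤ 1 := by
      have hnn : 0 ≤ a ^ 2 * a' ^ 2 * (s ((m + 1 : ℕ) : ℝ) - s m) := by
        have : 0 ≤ s ((m + 1 : ℕ) : ℝ) - s m := by linarith
        positivity
      nlinarith [mul_nonneg hnn (by linarith : (0 : ℝ) ≤ s ((m + 1 : ℕ) : ℝ) + s m - 6)]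
    -- `(a' − a)(a' + a) = 1`
    have hdiff : (a' - a) * (a' + a) = 1 := by nlinarith [ha2, ha'2]
    -- from `φ(m) > 0`: `ω a > s(m) b ≥ 3b`
    have hφm : phi c δ M m = ω * a / b - s m := by rw [hω, ha, hb]; rfl
    have hωa : 3 * b ≤ ω * a := by
      have h1 : s m < ω * a / b := by rw [hφm] at hpos; linarith
      have h2 : s m * b < ω * a := by rwa [lt_div_iff₀ hbpos] at h1
      nlinarith
    -- conclude `φ(m) ≤ φ(m+1)` i.e. `b (s(m+1) − s(m)) ≤ ω (a' − a)`
    have hφm1 : phi c δ M (m + 1) = ω * a' / b - s ((m + 1 : ℕ) : ℝ) := by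
      rw [hω, ha', hb]; rfl
    rw [hφm, hφm1]
    have hkey : b * (s ((m + 1 : ℕ) : ℝ) - s m) ≤ ω * (a' - a) := by
      -- multiply through by `2 a² a'² (a' + a) > 0`
      have hd0 : 0 ≤ a' - a := by linarith
      have hsum : a' + a ≤ 2 * a' := by linarith
      -- ω(a'−a) ≥ ω/(2a') and b(s'−s) ≤ b/(2a²a'²); and ω a² a' ≥ b
      have hω0 : 0 ≤ ω := by linarith
      have h1 : ω ≤ ω * (a' - a) * (2 * a') := by
        have h11 : (a' - a) * (a' + a) ≤ (a' - a) * (2 * a') :=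
          mul_le_mul_of_nonneg_left hsum hd0
        have h12 : 1 ≤ (a' - a) * (2 * a') := by linarith [hdiff]
        have := mul_le_mul_of_nonneg_left h12 hω0
        linarith [this, (by ring : ω * ((a' - a) * (2 * a')) = ω * (a' - a) * (2 * a'))]
      have h2 : b * (s ((m + 1 : ℕ) : ℝ) - s m) * (2 * a ^ 2 * a' ^ 2) ≤ b := by
        have := mul_le_mul_of_nonneg_left hds hbpos.le
        have e : b * (s ((m + 1 : ℕ) : ℝ) - s m) * (2 * a ^ 2 * a' ^ 2) =
            b * (2 * (a ^ 2 * a' ^ 2 * (s ((m + 1 : ℕ) : ℝ) - s m))) := by ring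
        rw [e]; linarith
      have h3 : b ≤ ω * a ^ 2 * a' := by
        have haa : (1 : ℝ) * 1 ≤ a * a' := mul_le_mul ha1 (ha1.trans haa') zero_le_one hapos.le
        have haa1 : (1 : ℝ) ≤ a * a' := by linarith only [haa]
        have := mul_le_mul hωa haa1 (by norm_num) (by positivity)
        -- 3b·1 ≤ ω a · (a a')
        linarith only [this, hbpos, (by ring : ω * a * (a * a') = ω * a ^ 2 * a')]
      by_contra hcon
      push Not at hcon
      have hA : ω * (a' - a) * (2 * a ^ 2 * a' ^ 2) <
          b * (s ((m + 1 : ℕ) : ℝ) - s m) * (2 * a ^ 2 * a' ^ 2) :=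
        mul_lt_mul_of_pos_right hcon (by positivity)
      have hB : ω * (a' - a) * (2 * a ^ 2 * a' ^ 2) < ω * a ^ 2 * a' := by
        linarith only [hA, h2, h3]
      have hC : ω * (a' - a) * (2 * a') * (a ^ 2 * a') < ω * (a ^ 2 * a') := by
        linarith only [hB, (by ring : ω * (a' - a) * (2 * a') * (a ^ 2 * a') =
          ω * (a' - a) * (2 * a ^ 2 * a' ^ 2)), (by ring : ω * (a ^ 2 * a') = ω * a ^ 2 * a')]
      have hD : ω * (a ^ 2 * a') ≤ ω * (a' - a) * (2 * a') * (a ^ 2 * a') :=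
        mul_le_mul_of_nonneg_right h1 (by positivity)
      linarith only [hC, hD]
    have h := div_le_div_of_nonneg_right hkey hbpos.le
    have e1 : b * (s ((m + 1 : ℕ) : ℝ) - s m) / b = s ((m + 1 : ℕ) : ℝ) - s m := by
      field_simp
    have e2 : ω * (a' - a) / b = ω * a' / b - ω * a / b := by ring
    linarith only [h, e1, e2]

set_option maxHeartbeats 400000 in
/-- L2(b), the CAP: `θ_w(m) ≤ 1 − δ/(c√m)` for `1 ≤ m ≤ M` (equality of `c√m − δ − Ψ₂(m)` with
`0` exactly at `m = M`). -/
theorem thetaW_cap {c δ : ℝ} (hc : 0 < c) (hc2 : c ≤ 2) (hδ : 0 ≤ δ) (hδc : δ ≤ c) {M : ℕ}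
    (hM : 31 ≤ M) {m : ℕ} (hm : 1 ≤ m) (hmM : m ≤ M) :
    thetaW c δ M m ≤ 1 - δ / (c * Real.sqrt m) := by
  have hm' : (1 : ℝ) ≤ m := by exact_mod_cast hm
  have hmM' : (m : ℝ) ≤ M := by exact_mod_cast hmM
  have hM1 : (1 : ℝ) ≤ M := hm'.trans hmM'
  have hmpos : (0 : ℝ) < m := by linarith
  have hMpos : (0 : ℝ) < M := by linarith
  -- `a = √m`, `b = √M`
  set a : ℝ := Real.sqrt m with ha
  set b : ℝ := Real.sqrt M with hb
  have ha2 : a ^ 2 = m := by rw [ha]; exact Real.sq_sqrt hmpos.le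
  have hb2 : b ^ 2 = M := by rw [hb]; exact Real.sq_sqrt hMpos.le
  have ha1 : 1 ≤ a := by
    rw [ha, show (1 : ℝ) = Real.sqrt 1 from Real.sqrt_one.symm]; exact Real.sqrt_le_sqrt hm'
  have hab : a ≤ b := by rw [ha, hb]; exact Real.sqrt_le_sqrt hmM'
  have hapos : 0 < a := by linarith
  have hbpos : 0 < b := by linarith
  have ha0 : a ≠ 0 := ne_of_gt hapos
  have hb0 : b ≠ 0 := ne_of_gt hbpos
  have hc0 : c ≠ 0 := ne_of_gt hc
  have hm0 : (m : ℝ) ≠ 0 := ne_of_gt hmpos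
  have hM0 : (M : ℝ) ≠ 0 := ne_of_gt hMpos
  -- `sm = s(m)`, `sM = s(M)`: `3 ≤ sm ≤ sM`, `sM² − sm² = 3/m − 3/M`
  have h3m : 3 / (m : ℝ) ≤ 3 := by
    rw [div_le_iff₀ hmpos]; linarith
  have h3M : 3 / (M : ℝ) ≤ 3 / m := div_le_div_of_nonneg_left (by norm_num) hmpos hmM'
  have h3Mnn : 0 ≤ 3 / (M : ℝ) := by positivity
  have hsm3 : 3 ≤ s m := by
    unfold s
    have h9 : Real.sqrt 9 = 3 := by
      rw [show (9 : ℝ) = 3 ^ 2 by norm_num]; exact Real.sqrt_sq (by norm_num)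
    calc (3 : ℝ) = Real.sqrt 9 := h9.symm
      _ ≤ Real.sqrt (12 - 3 / (m : ℝ)) := Real.sqrt_le_sqrt (by linarith)
  have hsmM : s m ≤ s M := by
    unfold s; exact Real.sqrt_le_sqrt (by linarith)
  have hsm2 : s m ^ 2 = 12 - 3 / m := by unfold s; exact Real.sq_sqrt (by linarith)
  have hsM2 : s M ^ 2 = 12 - 3 / M := by unfold s; exact Real.sq_sqrt (by linarith)
  -- step 1: `2a²b²(sM − sm) ≤ b² − a²`
  have hprod : 2 * a ^ 2 * b ^ 2 * ((s M - s m) * (s M + s m)) = 6 * (b ^ 2 - a ^ 2) := by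
    have e : (s M - s m) * (s M + s m) = s M ^ 2 - s m ^ 2 := by ring
    rw [e, hsM2, hsm2, ha2, hb2]
    field_simp
    ring
  have hstep1 : 2 * a ^ 2 * b ^ 2 * (s M - s m) ≤ b ^ 2 - a ^ 2 := by
    have hnn : 0 ≤ 2 * a ^ 2 * b ^ 2 * (s M - s m) := by
      have : 0 ≤ s M - s m := by linarith
      positivity
    nlinarith [mul_nonneg hnn (by linarith : (0 : ℝ) ≤ s M + s m - 6)]
  -- step 2: the polynomial inequality `G ≥ 0`
  have hQ : 0 ≤ 2 * c * a * b ^ 2 + 2 * a * b ^ 2 * s m - 2 * b * δ * (a + b) - (a + b) := by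
    have h1 : 2 * b ^ 2 * (c + 3) ≤ 2 * a * b ^ 2 * (c + s m) := by
      have : b ^ 2 * (c + 3) ≤ a * b ^ 2 * (c + s m) := by
        calc b ^ 2 * (c + 3) = 1 * (b ^ 2 * (c + 3)) := by ring
          _ ≤ a * (b ^ 2 * (c + s m)) :=
              mul_le_mul ha1 (mul_le_mul_of_nonneg_left (by linarith) (by positivity))
                (by positivity) hapos.le
          _ = a * b ^ 2 * (c + s m) := by ring
      linarith
    have h2 : 2 * b * δ * (a + b) + (a + b) ≤ 4 * b ^ 2 * δ + 2 * b := by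
      have : (a + b) * (2 * b * δ + 1) ≤ (2 * b) * (2 * b * δ + 1) :=
        mul_le_mul_of_nonneg_right (by linarith) (by positivity)
      nlinarith
    have hb1 : 1 ≤ b := ha1.trans hab
    nlinarith [mul_nonneg (by positivity : (0 : ℝ) ≤ b ^ 2) (sub_nonneg.2 hδc),
      mul_nonneg (by linarith : (0 : ℝ) ≤ b - 1) hbpos.le,
      mul_nonneg (by positivity : (0 : ℝ) ≤ b ^ 2) (by linarith : (0 : ℝ) ≤ 2 - δ)]
  have hG : 0 ≤ c * a * b ^ 2 - δ * b ^ 2 - (c + s M) * a ^ 2 * b + δ * a ^ 2 + s m * a * b ^ 2 := by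
    have hba : 0 ≤ b - a := sub_nonneg.2 hab
    have h2bG : 0 ≤ 2 * b * (c * a * b ^ 2 - δ * b ^ 2 - (c + s M) * a ^ 2 * b + δ * a ^ 2
        + s m * a * b ^ 2) := by
      nlinarith [mul_nonneg hba hQ, hstep1]
    have h2b : 0 < 2 * b := by linarith
    nlinarith [h2bG, h2b]
  -- conclude
  have hne : m ≠ 0 := by omega
  simp only [thetaW, hne, if_false]
  rw [div_le_iff₀ hc]
  have hφ : phi c δ M m ≤ c - δ / a := by
    have e : phi c δ M m - (c - δ / a) =
        -(c * a * b ^ 2 - δ * b ^ 2 - (c + s M) * a ^ 2 * b + δ * a ^ 2 + s m * a * b ^ 2)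
          / (a * b ^ 2) := by
      unfold phi omega
      rw [← ha, ← hb]
      field_simp
      ring
    have : -(c * a * b ^ 2 - δ * b ^ 2 - (c + s M) * a ^ 2 * b + δ * a ^ 2 + s m * a * b ^ 2)
          / (a * b ^ 2) ≤ 0 :=
      div_nonpos_of_nonpos_of_nonneg (by linarith) (by positivity)
    linarith
  have hδa : δ / a ≤ c := by
    rw [div_le_iff₀ hapos]; nlinarith
  have htarget : (1 - δ / (c * a)) * c = c - δ / a := by
    field_simp
  rw [htarget]
  exact max_le hφ (by linarith)

end Summit.Ventures.Crystal3D.Theorems.OptimalCalibration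

end
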